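import Summits.PneNP.PneNP.Theses.PermanentDescent

/-!
# Route PermanentDescent — `Assembly` (stmt-PneNP-16003)

`Assembly := UniformizationUnderCollapse → CollapseShrinksPermanent → PermanentNotInP → PneNP`. The two collapse items compose to
`CollapseMakesPermanentEasy` (`NP ⊆ P → PermBits ∈ P`: shrink to `P/poly`, then uniformize), and the route's deciding theorem
`Summit.PneNP.PneNP.Theses.PermanentDescent.closes : CollapseMakesPermanentEasy → PermanentNotInP → PneNP` concludes.
This file imports only the route file (cone hygiene).
-/

set_option linter.dupNamespace false -- `Summit.PneNP.PneNP.…`: summit = sub-problem name (D-0017 single-conjunct layout)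

namespace Summit.PneNP.PneNP.Theorems

/-- **Assembly item of route PermanentDescent (stmt-PneNP-16003)**:
`UniformizationUnderCollapse → CollapseShrinksPermanent → PermanentNotInP → PneNP` — compose the two collapse steps into
`CollapseMakesPermanentEasy` and apply the route's deciding theorem `PermanentDescent.closes`. [folklore] -/
theorem permanentDescent_assembly_proof : Summit.PneNP.PneNP.Theses.PermanentDescent.Assembly := by
  unfold Summit.PneNP.PneNP.Theses.PermanentDescent.Assembly
  intro u k w
  refine Summit.PneNP.PneNP.Theses.PermanentDescent.closes ?_ w
  unfold Summit.PneNP.PneNP.Theses.PermanentDescent.CollapseMakesPermanentEasy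
  unfold Summit.PneNP.PneNP.Theses.PermanentDescent.UniformizationUnderCollapse at u
  unfold Summit.PneNP.PneNP.Theses.PermanentDescent.CollapseShrinksPermanent at k
  exact fun h => u h (k h)

end Summit.PneNP.PneNP.Theorems
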